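import Summits.KontsevichZagierPeriods.KontsevichZagierPeriods.Theorems.SoloInformedNLBandPieces
import HarnessLib
import HarnessLib.Audit

/-!
# SoloInformed — the frame of a Newton–Leibniz datum: smooth loci, sign sets and the first adapted decomposition (Newton–Leibniz elimination, file 4c-ii-d1)

Solo programme `solo-KontsevichZagierPeriods-informed`, session s245 (K-NF, `paper/nl-elimination.md`
§7.2, FILE 4c-ii, assembly part 1).

A `SoloInformedNLFrame n` bundles a Newton–Leibniz datum `(r, r', a, b, F)` (exactly the data of
`KZ.newtonLeibnizRel`) with the auxiliary objects of the proof of THEOREM NF: the smooth loci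
`GF ⊆ B` of `F`, `Gg ⊆ τ` of `g = r'.integrand`, `Gh ⊆ τ` of `h = F(·, a ·)` (null complements,
`KZ.exists_isOpen_contDiffOn`), and ONE `ℚ`-cylindrical decomposition `𝒯` of `ℝⁿ⁺¹` with its stack
data, adapted to the band `B`, the sign sets `P, N, Z ⊆ GF` of `f = r.integrand`, and the cylinders
over `τ`, `τ⁺, τ⁻` (sign sets of `g` inside `Gg ∩ Gh`) and `τ⁰ = {g = 0}`.

* `soloInformed_exists_frame`: every Newton–Leibniz datum has a frame (BPR Cor. 5.7);
* trichotomies: an open base cell inside `τ` lies in `τ⁺`, `τ⁻` or `τ⁰`; an open band inside `B`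
  lies in `P`, `N` or `Z` (adaptedness + null complements + open cells have positive measure).

References: Basu–Pollack–Roy (2006), Cor. 5.7; this work (THEOREM NF, `paper/nl-elimination.md` §2).
-/

noncomputable section

open scoped BigOperators Topology ContDiff

namespace Summit.KontsevichZagierPeriods.KontsevichZagierPeriods.Theorems

open Set MeasureTheory Filter
open Literature.ModelTheory.ExponentialFields
open Literature.NumberTheory.Transcendental Literature.NumberTheory.Transcendental.KZ

variable {n : ℕ}

/-- **Frame of a Newton–Leibniz datum**: the datum, the smooth loci of `F`, `g`, `h`, and a
`ℚ`-cylindrical decomposition of `ℝⁿ⁺¹` (with stack data) adapted to the band, the sign sets of the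
integrand and the cylinders over `τ, τ⁺, τ⁻, τ⁰`. -/
structure SoloInformedNLFrame (n : ℕ) where
  /-- the `(n+1)`-dimensional side `[B, f]` -/
  r : IntegralRep (n + 1)
  /-- the `n`-dimensional side `[τ, g]` -/
  r' : IntegralRep n
  /-- lower endpoint -/
  a : (Fin n → ℝ) → ℝ
  /-- upper endpoint -/
  b : (Fin n → ℝ) → ℝ
  /-- the primitive -/
  F : (Fin (n + 1) → ℝ) → ℝ
  hF : IsSemialgebraicFunOn ℚ r.domain F
  ha : IsSemialgebraicFunOn ℚ r'.domain a
  hb : IsSemialgebraicFunOn ℚ r'.domain b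
  hab : ∀ x ∈ r'.domain, a x ≤ b x
  hdom : r.domain = KZlog.band r'.domain a b
  hcont : ∀ x ∈ r'.domain, ContinuousOn (fun t : ℝ => F (Fin.snoc x t)) (Icc (a x) (b x))
  hderiv : ∀ x ∈ r'.domain, ∀ t ∈ Ioo (a x) (b x),
    HasDerivAt (fun s : ℝ => F (Fin.snoc x s)) (r.integrand (Fin.snoc x t)) t
  hr' : ∀ x ∈ r'.domain, r'.integrand x = F (Fin.snoc x (b x)) - F (Fin.snoc x (a x))
  /-- smooth locus of `F` in the band -/
  GF : Set (Fin (n + 1) → ℝ)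
  hGF : GF ⊆ r.domain ∧ IsOpen GF ∧ IsSemialgebraic ℚ GF ∧ ContDiffOn ℝ ∞ F GF ∧
    volume (r.domain \ GF) = 0
  /-- smooth locus of `g = r'.integrand` -/
  Gg : Set (Fin n → ℝ)
  hGg : Gg ⊆ r'.domain ∧ IsOpen Gg ∧ IsSemialgebraic ℚ Gg ∧ ContDiffOn ℝ ∞ r'.integrand Gg ∧
    volume (r'.domain \ Gg) = 0
  /-- smooth locus of `h = F(·, a ·)` -/
  Gh : Set (Fin n → ℝ)
  hGh : Gh ⊆ r'.domain ∧ IsOpen Gh ∧ IsSemialgebraic ℚ Gh ∧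
    ContDiffOn ℝ ∞ (fun x => F (Fin.snoc x (a x))) Gh ∧ volume (r'.domain \ Gh) = 0
  /-- the decomposition of `ℝⁿ⁺¹` -/
  𝒯 : Finset (Set (Fin (n + 1) → ℝ))
  h𝒯 : IsCylindricalDecomposition ℚ (n + 1) 𝒯
  /-- its base decomposition -/
  𝒮 : Finset (Set (Fin n → ℝ))
  h𝒮 : IsCylindricalDecomposition ℚ n 𝒮
  /-- number of sections over a base cell -/
  lS : Set (Fin n → ℝ) → ℕ
  /-- the sections -/
  ξ : (S : Set (Fin n → ℝ)) → Fin (lS S) → (Fin n → ℝ) → ℝ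
  hcontξ : ∀ S ∈ 𝒮, ∀ j, ContinuousOn (ξ S j) S
  hsaξ : ∀ S ∈ 𝒮, ∀ j, IsSemialgebraicFunOn ℚ S (ξ S j)
  hmono : ∀ S ∈ 𝒮, ∀ x ∈ S, StrictMono fun j => ξ S j x
  hmem : ∀ T, T ∈ 𝒯 ↔ ∃ S ∈ 𝒮, (∃ j, T = graphOver S (ξ S j)) ∨ ∃ j, T = bandOver S (ξ S) j
  adB : ∃ 𝒞, 𝒞 ⊆ 𝒯 ∧ ⋃₀ (𝒞 : Set (Set (Fin (n + 1) → ℝ))) = r.domain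
  adP : ∃ 𝒞, 𝒞 ⊆ 𝒯 ∧ ⋃₀ (𝒞 : Set (Set (Fin (n + 1) → ℝ))) = {z | z ∈ GF ∧ 0 < r.integrand z}
  adN : ∃ 𝒞, 𝒞 ⊆ 𝒯 ∧ ⋃₀ (𝒞 : Set (Set (Fin (n + 1) → ℝ))) = {z | z ∈ GF ∧ r.integrand z < 0}
  adZ : ∃ 𝒞, 𝒞 ⊆ 𝒯 ∧ ⋃₀ (𝒞 : Set (Set (Fin (n + 1) → ℝ))) = {z | z ∈ GF ∧ r.integrand z = 0}
  adτ : ∃ 𝒞, 𝒞 ⊆ 𝒯 ∧ ⋃₀ (𝒞 : Set (Set (Fin (n + 1) → ℝ))) =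
    {z : Fin (n + 1) → ℝ | Fin.init z ∈ r'.domain}
  adp : ∃ 𝒞, 𝒞 ⊆ 𝒯 ∧ ⋃₀ (𝒞 : Set (Set (Fin (n + 1) → ℝ))) =
    {z : Fin (n + 1) → ℝ | Fin.init z ∈ {x | x ∈ Gg ∩ Gh ∧ 0 < r'.integrand x}}
  adm : ∃ 𝒞, 𝒞 ⊆ 𝒯 ∧ ⋃₀ (𝒞 : Set (Set (Fin (n + 1) → ℝ))) =
    {z : Fin (n + 1) → ℝ | Fin.init z ∈ {x | x ∈ Gg ∩ Gh ∧ r'.integrand x < 0}}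
  ad0 : ∃ 𝒞, 𝒞 ⊆ 𝒯 ∧ ⋃₀ (𝒞 : Set (Set (Fin (n + 1) → ℝ))) =
    {z : Fin (n + 1) → ℝ | Fin.init z ∈ {x | x ∈ r'.domain ∧ r'.integrand x = 0}}

/-- The lower endpoint graph lies in the band. -/
theorem soloInformed_snoc_mem_band_left {τ : Set (Fin n → ℝ)} {a b : (Fin n → ℝ) → ℝ}
    (hab : ∀ x ∈ τ, a x ≤ b x) {x : Fin n → ℝ} (hx : x ∈ τ) :
    (Fin.snoc x (a x) : Fin (n + 1) → ℝ) ∈ KZlog.band τ a b :=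
  KZlog.snoc_mem_band.2 ⟨hx, le_rfl, hab x hx⟩

/-- The upper endpoint graph lies in the band. -/
theorem soloInformed_snoc_mem_band_right {τ : Set (Fin n → ℝ)} {a b : (Fin n → ℝ) → ℝ}
    (hab : ∀ x ∈ τ, a x ≤ b x) {x : Fin n → ℝ} (hx : x ∈ τ) :
    (Fin.snoc x (b x) : Fin (n + 1) → ℝ) ∈ KZlog.band τ a b :=
  KZlog.snoc_mem_band.2 ⟨hx, hab x hx, le_rfl⟩

/-- **Every Newton–Leibniz datum has a frame.** [BPR 2006, Cor. 5.7] -/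
theorem soloInformed_exists_frame (r : IntegralRep (n + 1)) (r' : IntegralRep n)
    (a b : (Fin n → ℝ) → ℝ) (F : (Fin (n + 1) → ℝ) → ℝ) (hF : IsSemialgebraicFunOn ℚ r.domain F)
    (ha : IsSemialgebraicFunOn ℚ r'.domain a) (hb : IsSemialgebraicFunOn ℚ r'.domain b)
    (hab : ∀ x ∈ r'.domain, a x ≤ b x) (hdom : r.domain = KZlog.band r'.domain a b)
    (hcont : ∀ x ∈ r'.domain, ContinuousOn (fun t : ℝ => F (Fin.snoc x t)) (Icc (a x) (b x)))
    (hderiv : ∀ x ∈ r'.domain, ∀ t ∈ Ioo (a x) (b x),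
      HasDerivAt (fun s : ℝ => F (Fin.snoc x s)) (r.integrand (Fin.snoc x t)) t)
    (hr' : ∀ x ∈ r'.domain, r'.integrand x = F (Fin.snoc x (b x)) - F (Fin.snoc x (a x))) :
    ∃ Φ : SoloInformedNLFrame n, Φ.r = r ∧ Φ.r' = r' := by
  classical
  have hh : IsSemialgebraicFunOn ℚ r'.domain (fun x => F (Fin.snoc x (a x))) :=
    soloInformed_isSemialgebraicFunOn_comp_snoc r'.isSemialgebraic_domain ha hF
      (fun x hx => hdom ▸ soloInformed_snoc_mem_band_left hab hx)
  obtain ⟨GF, hGFsub, hGFo, hGFsa, hGFsm, -, hGFnull⟩ :=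
    exists_isOpen_contDiffOn r.isSemialgebraic_domain hF
  obtain ⟨Gg, hGgsub, hGgo, hGgsa, hGgsm, -, hGgnull⟩ :=
    exists_isOpen_contDiffOn r'.isSemialgebraic_domain r'.isSemialgebraicFunOn_integrand
  obtain ⟨Gh, hGhsub, hGho, hGhsa, hGhsm, -, hGhnull⟩ :=
    exists_isOpen_contDiffOn r'.isSemialgebraic_domain hh
  have hfG : IsSemialgebraicFunOn ℚ GF r.integrand := r.isSemialgebraicFunOn_integrand.mono hGFsub hGFsa
  have hGgh : IsSemialgebraic ℚ (Gg ∩ Gh) := hGgsa.inter hGhsa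
  have hgG : IsSemialgebraicFunOn ℚ (Gg ∩ Gh) r'.integrand :=
    r'.isSemialgebraicFunOn_integrand.mono (fun x hx => hGgsub hx.1) hGgh
  -- the eight sets
  set B := r.domain with hB
  set P := {z | z ∈ GF ∧ 0 < r.integrand z} with hP
  set N := {z | z ∈ GF ∧ r.integrand z < 0} with hN
  set Z := {z | z ∈ GF ∧ r.integrand z = 0} with hZ
  set Cτ := {z : Fin (n + 1) → ℝ | Fin.init z ∈ r'.domain} with hCτ
  set Cp := {z : Fin (n + 1) → ℝ | Fin.init z ∈ {x | x ∈ Gg ∩ Gh ∧ 0 < r'.integrand x}} with hCp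
  set Cm := {z : Fin (n + 1) → ℝ | Fin.init z ∈ {x | x ∈ Gg ∩ Gh ∧ r'.integrand x < 0}} with hCm
  set C0 := {z : Fin (n + 1) → ℝ | Fin.init z ∈ {x | x ∈ r'.domain ∧ r'.integrand x = 0}} with hC0
  have sB : IsSemialgebraic ℚ B := r.isSemialgebraic_domain
  have sP : IsSemialgebraic ℚ P := soloInformed_isSemialgebraic_sep_pos hfG
  have sN : IsSemialgebraic ℚ N := soloInformed_isSemialgebraic_sep_neg hfG
  have sZ : IsSemialgebraic ℚ Z := soloInformed_isSemialgebraic_sep_eq_zero hfG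
  have sCτ : IsSemialgebraic ℚ Cτ := r'.isSemialgebraic_domain.setOf_init_mem
  have sCp : IsSemialgebraic ℚ Cp := (soloInformed_isSemialgebraic_sep_pos hgG).setOf_init_mem
  have sCm : IsSemialgebraic ℚ Cm := (soloInformed_isSemialgebraic_sep_neg hgG).setOf_init_mem
  have sC0 : IsSemialgebraic ℚ C0 :=
    (soloInformed_isSemialgebraic_sep_eq_zero r'.isSemialgebraicFunOn_integrand).setOf_init_mem
  let Fam : Finset (Set (Fin (n + 1) → ℝ)) := {B, P, N, Z, Cτ, Cp, Cm, C0}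
  have hFam : ∀ s ∈ Fam, IsSemialgebraic ℚ s := by
    intro s hs
    simp only [Fam, Finset.mem_insert, Finset.mem_singleton] at hs
    rcases hs with rfl | rfl | rfl | rfl | rfl | rfl | rfl | rfl <;> assumption
  obtain ⟨𝒯, h𝒯, had⟩ := IsSemialgebraic.exists_cylindricalDecomposition_holds (k := ℚ) Fam hFam
  obtain ⟨-, -, 𝒮, h𝒮, lS, ξ, hcontξ, hsaξ, hmono, hmem⟩ := isCylindricalDecomposition_succ.1 h𝒯
  have had' : ∀ s ∈ Fam, ∃ 𝒞, 𝒞 ⊆ 𝒯 ∧ ⋃₀ (𝒞 : Set (Set (Fin (n + 1) → ℝ))) = s :=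
    fun s hs => by obtain ⟨𝒞, h1, h2⟩ := had s hs; exact ⟨𝒞, h1, h2⟩
  exact ⟨
    { r := r
      r' := r'
      a := a
      b := b
      F := F
      hF := hF
      ha := ha
      hb := hb
      hab := hab
      hdom := hdom
      hcont := hcont
      hderiv := hderiv
      hr' := hr'
      GF := GF
      hGF := ⟨hGFsub, hGFo, hGFsa, hGFsm, hGFnull⟩
      Gg := Gg
      hGg := ⟨hGgsub, hGgo, hGgsa, hGgsm, hGgnull⟩
      Gh := Gh
      hGh := ⟨hGhsub, hGho, hGhsa, hGhsm, hGhnull⟩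
      𝒯 := 𝒯
      h𝒯 := h𝒯
      𝒮 := 𝒮
      h𝒮 := h𝒮
      lS := lS
      ξ := ξ
      hcontξ := hcontξ
      hsaξ := hsaξ
      hmono := hmono
      hmem := hmem
      adB := had' B (by simp [Fam])
      adP := had' P (by simp [Fam])
      adN := had' N (by simp [Fam])
      adZ := had' Z (by simp [Fam])
      adτ := had' Cτ (by simp [Fam])
      adp := had' Cp (by simp [Fam])
      adm := had' Cm (by simp [Fam])
      ad0 := had' C0 (by simp [Fam]) }, rfl, rfl⟩

namespace SoloInformedNLFrame

variable (Φ : SoloInformedNLFrame n)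

/-- The positivity set `P = {f > 0} ∩ GF`. -/
def P : Set (Fin (n + 1) → ℝ) := {z | z ∈ Φ.GF ∧ 0 < Φ.r.integrand z}

/-- The negativity set `N = {f < 0} ∩ GF`. -/
def N : Set (Fin (n + 1) → ℝ) := {z | z ∈ Φ.GF ∧ Φ.r.integrand z < 0}

/-- The zero set `Z = {f = 0} ∩ GF`. -/
def Z : Set (Fin (n + 1) → ℝ) := {z | z ∈ Φ.GF ∧ Φ.r.integrand z = 0}

/-- `τ⁺ = {g > 0} ∩ Gg ∩ Gh`. -/
def τp : Set (Fin n → ℝ) := {x | x ∈ Φ.Gg ∩ Φ.Gh ∧ 0 < Φ.r'.integrand x}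

/-- `τ⁻ = {g < 0} ∩ Gg ∩ Gh`. -/
def τm : Set (Fin n → ℝ) := {x | x ∈ Φ.Gg ∩ Φ.Gh ∧ Φ.r'.integrand x < 0}

/-- `τ⁰ = {g = 0} ∩ τ`. -/
def τ0 : Set (Fin n → ℝ) := {x | x ∈ Φ.r'.domain ∧ Φ.r'.integrand x = 0}

/-- The cells of `𝒯` partition `ℝⁿ⁺¹`. -/
theorem hpart : Setoid.IsPartition (Φ.𝒯 : Set (Set (Fin (n + 1) → ℝ))) := Φ.h𝒯.isPartition

/-- The base cells partition `ℝⁿ`. -/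
theorem hpartS : Setoid.IsPartition (Φ.𝒮 : Set (Set (Fin n → ℝ))) := Φ.h𝒮.isPartition

/-- Bands over base cells are cells, hence `ℚ`-semialgebraic. -/
theorem band_mem {S : Set (Fin n → ℝ)} (hS : S ∈ Φ.𝒮) (j : Fin (Φ.lS S + 1)) :
    bandOver S (Φ.ξ S) j ∈ Φ.𝒯 :=
  (Φ.hmem _).2 ⟨S, hS, Or.inr ⟨j, rfl⟩⟩

/-- Bands over base cells are `ℚ`-semialgebraic. -/
theorem isSemialgebraic_band {S : Set (Fin n → ℝ)} (hS : S ∈ Φ.𝒮) (j : Fin (Φ.lS S + 1)) :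
    IsSemialgebraic ℚ (bandOver S (Φ.ξ S) j) :=
  Φ.h𝒯.isSemialgebraic _ (Φ.band_mem hS j)

/-- A base cell meeting `τ` lies in `τ`. -/
theorem base_subset_of_mem {S : Set (Fin n → ℝ)} (hS : S ∈ Φ.𝒮) {x : Fin n → ℝ} (hx : x ∈ S)
    (hxτ : x ∈ Φ.r'.domain) : S ⊆ Φ.r'.domain := by
  obtain ⟨𝒞, h𝒞, hU⟩ := Φ.adτ
  rcases soloInformed_base_subset_or_disjoint Φ.hpart Φ.hmono Φ.hmem h𝒞 hU hS with h | h
  · exact h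
  · exact absurd hxτ (disjoint_left.1 h hx)

/-- **Trichotomy of open base cells inside `τ`**: such a cell lies in `τ⁺`, `τ⁻` or `τ⁰`. -/
theorem base_trichotomy {S : Set (Fin n → ℝ)} (hS : S ∈ Φ.𝒮) (hSo : IsOpen S)
    (hSτ : S ⊆ Φ.r'.domain) : S ⊆ Φ.τp ∨ S ⊆ Φ.τm ∨ S ⊆ Φ.τ0 := by
  obtain ⟨𝒞p, h𝒞p, hUp⟩ := Φ.adp
  obtain ⟨𝒞m, h𝒞m, hUm⟩ := Φ.adm
  obtain ⟨𝒞0, h𝒞0, hU0⟩ := Φ.ad0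
  rcases soloInformed_base_subset_or_disjoint Φ.hpart Φ.hmono Φ.hmem h𝒞p hUp hS with hp | hp
  · exact Or.inl hp
  rcases soloInformed_base_subset_or_disjoint Φ.hpart Φ.hmono Φ.hmem h𝒞m hUm hS with hm | hm
  · exact Or.inr (Or.inl hm)
  rcases soloInformed_base_subset_or_disjoint Φ.hpart Φ.hmono Φ.hmem h𝒞0 hU0 hS with h0 | h0
  · exact Or.inr (Or.inr h0)
  exfalso
  have hnull : volume ((Φ.r'.domain \ Φ.Gg) ∪ (Φ.r'.domain \ Φ.Gh)) = 0 :=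
    measure_union_null Φ.hGg.2.2.2.2 Φ.hGh.2.2.2.2
  refine soloInformed_not_subset_of_isOpen_of_volume_eq_zero Φ.h𝒮 hS hSo hnull fun x hx => ?_
  by_contra hxG
  simp only [mem_union, Set.mem_sdiff, not_or, not_and, not_not] at hxG
  have hg : x ∈ Φ.Gg := hxG.1 (hSτ hx)
  have hh : x ∈ Φ.Gh := hxG.2 (hSτ hx)
  rcases lt_trichotomy 0 (Φ.r'.integrand x) with hs | hs | hs
  · exact disjoint_left.1 hp hx ⟨⟨hg, hh⟩, hs⟩
  · exact disjoint_left.1 h0 hx ⟨hSτ hx, hs.symm⟩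
  · exact disjoint_left.1 hm hx ⟨⟨hg, hh⟩, hs⟩

/-- **Trichotomy of open bands inside `B`**: such a band lies in `P`, `N` or `Z`. -/
theorem band_trichotomy {S : Set (Fin n → ℝ)} (hS : S ∈ Φ.𝒮) {j : Fin (Φ.lS S + 1)}
    (hBo : IsOpen (bandOver S (Φ.ξ S) j)) (hBB : bandOver S (Φ.ξ S) j ⊆ Φ.r.domain) :
    bandOver S (Φ.ξ S) j ⊆ Φ.P ∨ bandOver S (Φ.ξ S) j ⊆ Φ.N ∨ bandOver S (Φ.ξ S) j ⊆ Φ.Z := by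
  obtain ⟨𝒞p, h𝒞p, hUp⟩ := Φ.adP
  obtain ⟨𝒞m, h𝒞m, hUm⟩ := Φ.adN
  obtain ⟨𝒞0, h𝒞0, hU0⟩ := Φ.adZ
  have hT := Φ.band_mem hS j
  rcases soloInformed_cell_subset_or_disjoint Φ.hpart h𝒞p hUp hT with hp | hp
  · exact Or.inl hp
  rcases soloInformed_cell_subset_or_disjoint Φ.hpart h𝒞m hUm hT with hm | hm
  · exact Or.inr (Or.inl hm)
  rcases soloInformed_cell_subset_or_disjoint Φ.hpart h𝒞0 hU0 hT with h0 | h0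
  · exact Or.inr (Or.inr h0)
  exfalso
  refine soloInformed_not_subset_of_isOpen_of_volume_eq_zero Φ.h𝒯 hT hBo Φ.hGF.2.2.2.2
    fun z hz => ⟨hBB hz, fun hzG => ?_⟩
  rcases lt_trichotomy 0 (Φ.r.integrand z) with hs | hs | hs
  · exact disjoint_left.1 hp hz ⟨hzG, hs⟩
  · exact disjoint_left.1 h0 hz ⟨hzG, hs.symm⟩
  · exact disjoint_left.1 hm hz ⟨hzG, hs⟩

/-- `h = F(·, a ·)` is `ℚ`-semialgebraic on `τ`. -/
theorem isSemialgebraicFunOn_ha : IsSemialgebraicFunOn ℚ Φ.r'.domain (fun x => Φ.F (Fin.snoc x (Φ.a x))) :=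
  soloInformed_isSemialgebraicFunOn_comp_snoc Φ.r'.isSemialgebraic_domain Φ.ha Φ.hF
    (fun _ hx => Φ.hdom ▸ soloInformed_snoc_mem_band_left Φ.hab hx)

/-- `F(·, b ·)` is `ℚ`-semialgebraic on `τ`. -/
theorem isSemialgebraicFunOn_hb : IsSemialgebraicFunOn ℚ Φ.r'.domain (fun x => Φ.F (Fin.snoc x (Φ.b x))) :=
  soloInformed_isSemialgebraicFunOn_comp_snoc Φ.r'.isSemialgebraic_domain Φ.hb Φ.hF
    (fun _ hx => Φ.hdom ▸ soloInformed_snoc_mem_band_right Φ.hab hx)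

/-- On `τ⁺ ∪ τ⁻ ⊆ Gg ∩ Gh`, `g` and `h` are smooth; the sets are open. -/
theorem τp_subset : Φ.τp ⊆ Φ.Gg ∩ Φ.Gh := fun _ hx => hx.1

/-- `τ⁻ ⊆ Gg ∩ Gh`. -/
theorem τm_subset : Φ.τm ⊆ Φ.Gg ∩ Φ.Gh := fun _ hx => hx.1

/-- `Gg ∩ Gh ⊆ τ`. -/
theorem Ggh_subset : Φ.Gg ∩ Φ.Gh ⊆ Φ.r'.domain := fun _ hx => Φ.hGg.1 hx.1

/-- `F(x, b x) = h x + g x` on `τ`. -/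
theorem hF_b (x : Fin n → ℝ) (hx : x ∈ Φ.r'.domain) :
    Φ.F (Fin.snoc x (Φ.b x)) = Φ.F (Fin.snoc x (Φ.a x)) + Φ.r'.integrand x := by
  rw [Φ.hr' x hx]; ring

end SoloInformedNLFrame

end Summit.KontsevichZagierPeriods.KontsevichZagierPeriods.Theorems
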